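import Summits.Ventures.PercRepro.RankLevelSetCoreSevenOfFormSplitK
import Summits.Ventures.PercRepro.RankLevelSetCoreSevenOfForm
import Summits.Ventures.PercRepro.S1TriangleCountBoot
import Summits.Ventures.PercRepro.S1CoreFourCircuitSum
import Summits.Ventures.PercRepro.S1FiveCircuitCountSharpC
import Summits.Ventures.PercRepro.RankLevelSetLevelSixRowsNineToFifteen
import Summits.Ventures.PercRepro.S3SixWindow
import Summits.Ventures.PercRepro.RankLevelSetLevelSevenRowFortyFourTelForm
import Summits.Ventures.PercRepro.RankLevelSetLevelSevenRowFortyFourLarge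

/-!
# PercRepro — THE ROW `44` OF LEVEL `7` AT ITS RANK: C-025 AT `q = 7`, `p = 44`, FOR EVERY FINITE MATROID, ON THE TELESCOPING
COUNT WITH THE NULLITY SPLIT IN `k` STEPS (THE BOOTSTRAPPED TRIANGLE COUNT, T4⁺, THE CAPPED TAIL) (p8, gen 21; a feeder for S4 — the top of the `q = 7` window; the rows below `56` are chained
in RankLevelSetLevelSevenRowsFiftyFourToFiftyFive)

Level `7` at rank `44` by the per-rank wrapper `rls_succ_large_at 6 7 44` (p8 g0, S3SixWindow): level `6` at `43`
(`c025_six_all`) and the `e`-free core at `(44, d)` for every `d ≥ 8` — the cells `8 ≤ d ≤ 126` by their numeric forms ON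
THE TELESCOPING COUNT (`tel_form44`, RankLevelSetLevelSevenRowFortyFourTelForm: the `N`-side `nsideTel 44 d S3 S4 S5` with the
disjoint pair count and the per-level minimum of the quartic pair bound and the coloop telescoping; the nullity-capped
`Y`-tail, THE NULLITY SPLIT IN `k` STEPS per cell) through `c025_core_seven_of_form_splitk` (RankLevelSetCoreSevenOfFormSplitK) with `hs3` from THE BOOTSTRAPPED
TRIANGLE COUNT `S1.ncard_triangles_le_triBound` (S1TriangleCountBoot), `hs4` from p1's T4⁺
`S1.ncard_fourCircuits_le_fourCircuitBound` (S1CoreFourCircuitSum) and `hs5` from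
`S1.fortyEight_mul_ncard_five_circuits_le_sharp` (S1FiveCircuitCountSharpC), the coranks `d ≥ 127` by the large-corank
inequality at `(44, n ≥ 171)` (`largeSeven_all44`) through `c025_core_seven_large_of_ineq` (RankLevelSetCoreSevenOfForm).
* **`c025_core_seven_at_forty_four`** — the `e`-free core at rank `44`, every corank `d ≥ 8`;
* **`c025_seven_at_forty_four`** — level `7` at rank `44`, every finite matroid.
Axioms: standard.
-/

open scoped Matroid

namespace PercRepro

namespace ThmN

variable {α : Type}

/-- **The `e`-free core of level `7` at rank `44`, every corank `d ≥ 8`**: the numeric forms of the cells `(44, 8 … 126)` on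
the telescoping count with the bootstrapped triangle count, p1's T4⁺ and the sharp five-circuit count, the capped tail, and the
large-corank inequality at `(44, n ≥ 171)`. -/
theorem c025_core_seven_at_forty_four (M : Matroid α) [M.Finite] (d : ℕ) (hd8 : 8 ≤ d) (hR : M.eRank = (44 : ℕ∞))
    (hn : M.E.ncard = 44 + d) (hfree : EFree M) : RLS M 44 7 := by
  rcases Nat.lt_or_ge d 127 with h | h
  · -- the circuit bounds: the sharper triangle count, the sharp four- and five-circuit counts
    have hd : M.E.encard = M.eRank + d := by
      rw [hR, ← M.ground_finite.cast_ncard_eq, hn]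
      push_cast
      ring
    have hs : ∀ e ∈ M.E, ∀ f ∈ M.E, e ≠ f → M.eRk {e, f} = 2 := by
      intro e he f hf hef
      have h2 : (2 : ℕ∞) ≤ M.eRk {e, f} :=
        two_le_eRk_of_two_le_ncard_of_free M hfree (Set.pair_subset he hf) (by rw [Set.ncard_pair hef])
      have h3 : M.eRk {e, f} ≤ 2 := by
        have := M.eRk_le_encard {e, f}
        rwa [Set.encard_pair hef] at this
      exact le_antisymm h3 h2
    have hC1 : ∀ L ⊆ M.E, M.eRk L = 2 → L.ncard ≤ 3 :=
      fun L hL hr => ncard_le_three_of_eRk_two M hs hfree hL hr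
    have hC3 : ∀ X ⊆ M.E, M.eRk X ≤ 4 → X.ncard ≤ 10 :=
      fun X hX hr => ncard_le_ten_of_eRk_le_four_of_free M hfree hX hr
    have hs3 : {C | M.IsCircuit C ∧ C.ncard = 3}.ncard ≤ S1.triBound d :=
      S1.ncard_triangles_le_triBound M hC1 hd
    have hs4 : {C | M.IsCircuit C ∧ C.ncard = 4}.ncard ≤ S1.fourCircuitBound d :=
      S1.ncard_fourCircuits_le_fourCircuitBound M hfree hd
    have hs5 : {C | M.IsCircuit C ∧ C.ncard = 5}.ncard ≤ 7 * d * (d + 1) * (d * d + d + 10) / 48 := by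
      have hT5 : 48 * {C : Set α | M.IsCircuit C ∧ C.ncard = 5}.ncard ≤ 7 * d * (d + 1) * (d * d + d + 10) :=
        S1.fortyEight_mul_ncard_five_circuits_le_sharp M hC3 hd
      rw [Nat.le_div_iff_mul_le (by norm_num)]
      linarith [hT5]
    exact c025_core_seven_of_form_splitk M 44 d (S1.triBound d) (S1.fourCircuitBound d)
      (7 * d * (d + 1) * (d * d + d + 10) / 48) hd8 hR hn hfree hs3 hs4 hs5 (tel_form44 d hd8 (by omega))
  · exact c025_core_seven_large_of_ineq M 44 hR (largeSeven_all44 M.E.ncard (by omega)) hfree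

/-- **Level `7` at rank `44`, every finite matroid**: `rls_succ_large_at 6 7 44` on level `6` at `43` (`c025_six_all`), the
coranks `≤ 7` (`U = ∅` or Theorem M) and the core at `44`. -/
theorem c025_seven_at_forty_four (M : Matroid α) [M.Finite] : RLS M 44 7 := by
  refine rls_succ_large_at (α := α) 6 7 44 (by norm_num) (fun M _ => c025_six_all M 43 (by norm_num)) ?_ ?_ M
  · -- corank `≤ 7`: `U = ∅` or Theorem M
    intro M _ hn
    rcases Nat.lt_or_ge M.E.ncard (44 + 7) with h | h
    · exact RLS_of_ncard_lt M h
    · exact RLS_of_ncard_eq M (by omega)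
  · -- the core at corank `≥ 8`
    intro M _ hR hbig hfree
    exact c025_core_seven_at_forty_four M (M.E.ncard - 44) (by omega) hR (by omega) hfree

end ThmN

end PercRepro
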